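import Summits.QuantumFields.BalabanUV.Beta.FP.NestedDressingProjectorLocality

/-!
# `BalabanUV.Beta.FP.NestedDressingProjectorBounds` — road «FP» for binder row D1, R-FP-45 (B), row NESTED-DRESS, FILE 3: ℝ-HOMOGENEITY (the units
# letter `hPu` at the Form level), SUP-BOUNDS (`|σ^{(m)} A x| ≤ 2·d·(m·Lc^m)·‖A‖_∞`, `|(Π^{(m)} A)_κ(x)| ≤ (1 + 4·d·(m·Lc^m))·‖A‖_∞` — asym1's `hΠbd` in sup form,
# j-uniform, constant per `m`), AND THE MATRIX WINDOW (an entry of `Π^{(m)}_nest` vanishes unless the source bond is the target bond or lies inside one of the two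
# `Lc^m`-blocks met by it), AND THE TOWER `Π^{(m)}∘Π^{(m+k)} = Π^{(m+k)}` (the nesting is associative: `σ^{(m+k)} = σ^{(m)} + (σ^{(k)}∘𝒬̄^m)∘blk(Lc^m)`)

HONEST DEPENDENCY (page 1, mandatory): continuum YM on T⁴ ⇐ BetaPertH ∧ nine spine estimates (0/9 proved); BetaPertH ⇐ (D1) ∧ (D4) ∧ CAP+tail;
G-an2-4 gates asym, D1 and NE2/3/4.  HONEST FRAMING (cell contract, verbatim): «discharging `BetaPertH` makes Bałaban's UV stability UNCONDITIONAL —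
a real constructive-QFT result; it is NOT the continuum limit and NOT the Clay problem.»  THIS MODULE DISCHARGES NOTHING of the wall: [folklore] finite sums
on `ℤ^d` (generic `d`; in-block root `r ∈ box`; `1 ≤ N`, `1 ≤ Lc` where stated).  No `def`, no `def … : Prop`, nothing cited, 0 sorry; 0∕4 row-D1 binders;
NOT SDF, NOT D1, NOT BetaPertH, NOT continuum, NOT Clay.  «not in print; our bookkeeping».

ABSOLUTE RULE (cell charter, verbatim): «No internally-minted statement may enter as a cited fact. Every hypothesis is either kernel-proved in this package or a
verbatim quotation of a PUBLISHED theorem with page reference. The manuscript(s) under audit are NOT citable for their own disputed steps — they are the thing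
under adjudication; programme-internal (2001/route/tribunal) claims are never citable.»

WHY (RULING R-FP-45 ADOPTED l.33687, row NESTED-DRESS letters in asym1's transport form: `hΠloc` = range, `hΠbd` = operator bound, j-uniform, constant per `m`
(W-asym1-g87-1 l.33020 (b)); `hPu` = commutation with leg-type-constant units (c); OWNER GO l.33582 (v)(vi)).  FILE 2 gave the EXACT read set; this file gives
the explicit constants: every reading is a finite sum of `±A`-letters — at most `d·N` letters per symmetrised comb at blocking `N` (an2's `axial_length_le_of_root`,
in-block root), `L^(d+1)` letters per straight block average (normalised by `L^d`), `m` levels — so the bound is elementary counting, uniform in the background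
level `j` and in the root.  The kernelisation (an2's `piKSymBm` pattern for `Π^{(m)}_nest`) consumes exactly §1 (linearity), §3 (window) and §2 (bound).

CONTENTS ([folklore]): §1 `symTreeGaugeAt_smul`, `symGaugeAt_smul`, `blockMeanAt_smul'`, `symBmGaugeAt_smul`, `qbar_smul`, **`symNestGaugeAt_smul`**, **`symAxProjNestAt_smul`**,
`symNestGaugeAt_add`, `symAxProjNestAt_add` (ℝ-LINEARITY — the Form-level content of the units letter `hPu`); §2 `abs_treeGaugeAt_le_of_sup'`,
`abs_symTreeGaugeAt_le_of_sup`, `abs_symGaugeAt_le_of_sup`, `abs_blockMeanAt_le_of_sup'`, **`abs_symBmGaugeAt_le_of_sup`** (`≤ 2·(d·N·M)`), `abs_contourSum_le_of_sup'`,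
`abs_qbar_le_of_sup`, **`abs_qbar_iterate_le_of_sup`** (`≤ L^k·M`), **`abs_symNestGaugeAt_le_of_sup`** (`≤ 2·d·(m·Lc^m)·M`), **`abs_symAxProjNestAt_le_of_sup`**
(`≤ (1 + 4·d·(m·Lc^m))·M`); §3 `symAxProjNestAt_map_zero`, **`symAxProjNestAt_apply_eq_zero_of_vanish`** (THE WINDOW: if `A` vanishes on the bond `(κ,x)` and inside the
two `Lc^m`-blocks of `x`, `x + e_κ`, then `(Π^{(m)} A)_κ(x) = 0`); §4 THE TOWER — `liftBlk_liftBlk`, `liftBlk_one`, **`symNestGaugeAt_add_levels`** (`σ^{(m+k)} = σ^{(m)} + (σ^{(k)}∘𝒬̄^m)∘blk (Lc^m)`: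
the nesting is associative), `symNestGaugeAt_symAxProjNestAt_add` (`σ^{(m)}∘Π^{(m+k)} = 0`), **`symAxProjNestAt_symAxProjNestAt_add`** (`Π^{(m)}∘Π^{(m+k)} = Π^{(m+k)}`),
`symAxProjBmAt_symAxProjNestAt_succ` (`Π̂₁∘Π^{(k+1)} = Π^{(k+1)}` — leaf-02 g14's (E2)/(E3), the Form-level twin of the owner's `Π_nest = Π₁·G`).
Provenance: road FP swarm LEAF PROVER `b2b-balaban-beta-d1-formalise-leaf-06` gen 14, 2026-08-21, row NESTED-DRESS (owner assignment l.33213; GO l.33582).  Names PROVISIONAL.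
-/

namespace Summit.QuantumFields.BalabanUV.Beta.FP.NestedDressingProjectorBounds

noncomputable section

open Finset
open scoped BigOperators Nat
open Literature.MathematicalPhysics.QuantumFieldTheory.Balaban1983to89.Beta
open AffineAveraging (Form0 Form1 Site unitVec unitVec_apply dz box toSite blockSum contourSum)
open AveragingContours (grad axial blk blk_block)
open AxialProjector (grad_zero)
open AveragingContoursRooted (treeGaugeAt)
open Summit.QuantumFields.BalabanUV.Beta.KernelPermutation (psite psite_symm_apply_eq)
open Summit.QuantumFields.BalabanUV.Beta.ResolventPermutation (P1 P1_apply psite_mem_box)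
open Summit.QuantumFields.BalabanUV.Beta.AxialProjectorBlockMean (blockMeanAt grad_sub)
open Summit.QuantumFields.BalabanUV.Beta.AxialDressingRooted (mem_axial axial_length_le_of_root)
open Summit.QuantumFields.BalabanUV.Beta.SymmetrisedAxialPotential (symTreeGaugeAt symTreeGaugeAt_eq_sum blk_psite_symm card_perm_fin)
open Summit.QuantumFields.BalabanUV.Beta.SymmetrisedAxialGauge (factorial_ne_zero_real)
open Summit.QuantumFields.BalabanUV.Beta.SymmetrisedAxialGaugeBlockMean (symGaugeAt symBmGaugeAt symAxProjBmAt)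
open Summit.QuantumFields.BalabanUV.Beta.CompositeCorrectorLinear (treeGaugeAt_smul)
open Summit.QuantumFields.BalabanUV.Beta.CompositeCorrectorLocality (InBlockBond mem_inBlockBond)
open Summit.QuantumFields.BalabanUV.Beta.GAN24.RespStepBmDecompExact (abs_list_sum_le)
open Summit.QuantumFields.BalabanUV.Beta.FP.NestedDressingProjector
  (qbar liftBlk symNestGaugeAt symAxProjNestAt symNestGaugeAt_zero_left symNestGaugeAt_succ symNestGaugeAt_eq_sum symNestGaugeAt_sub symAxProjNestAt_sub
    symNestGaugeAt_map_zero blk_blk' symNestGaugeAt_grad blockMeanAt_symNestGaugeAt blockMeanAt_liftBlk liftBlk_zero)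
open Summit.QuantumFields.BalabanUV.Beta.CompositeCorrectorLocality (blk_one)
open Summit.QuantumFields.BalabanUV.Beta.FP.BlockMeanProjectorGrad (blockMeanAt_sub)
open Summit.QuantumFields.BalabanUV.Beta.FP.NestedDressingProjectorLocality (symAxProjNestAt_apply_eq_of_forall)

variable {d : ℕ}

/-! ## §1 ℝ-homogeneity and additivity (the Form-level content of the units letter `hPu`) -/

/-- [folklore] The symmetrised tree integral is ℝ-homogeneous in the field. -/
theorem symTreeGaugeAt_smul (c : ℝ) (ρ : Site d) (A : Form1 d ℝ) (L : ℕ) (x : Site d) :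
    symTreeGaugeAt ρ (c • A) L x = c * symTreeGaugeAt ρ A L x := by
  rw [symTreeGaugeAt_eq_sum, symTreeGaugeAt_eq_sum, Finset.mul_sum]
  refine Finset.sum_congr rfl fun σ _ => ?_
  have e : P1 σ (c • A) = c • P1 σ A := rfl
  rw [e, treeGaugeAt_smul]

/-- [folklore] … hence so is the normalised gauge `symGaugeAt`. -/
theorem symGaugeAt_smul (c : ℝ) (ρ : Site d) (A : Form1 d ℝ) (L : ℕ) : symGaugeAt ρ (c • A) L = c • symGaugeAt ρ A L := by
  funext x
  simp only [symGaugeAt, Pi.smul_apply, smul_eq_mul, symTreeGaugeAt_smul]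
  ring

/-- [folklore] `blockMeanAt` is ℝ-homogeneous (generic dimension). -/
theorem blockMeanAt_smul' (N : ℕ) (c : ℝ) (f : Form0 d ℝ) : blockMeanAt N (c • f) = c • blockMeanAt N f := by
  funext x
  simp only [blockMeanAt, AffineAveraging.blockSum, Pi.smul_apply, smul_eq_mul, ← Finset.mul_sum, mul_div_assoc]

/-- [folklore] **`σ₁` is ℝ-homogeneous**: `symBmGaugeAt ρ (c • A) L = c • symBmGaugeAt ρ A L`. -/
theorem symBmGaugeAt_smul (c : ℝ) (ρ : Site d) (A : Form1 d ℝ) (L : ℕ) : symBmGaugeAt ρ (c • A) L = c • symBmGaugeAt ρ A L := by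
  unfold symBmGaugeAt
  rw [symGaugeAt_smul, blockMeanAt_smul', smul_sub]

/-- [folklore] `𝒬̄` is ℝ-homogeneous. -/
theorem qbar_smul (L : ℕ) (c : ℝ) (A : Form1 d ℝ) : qbar L (c • A) = c • qbar L A := by
  funext κ y
  simp only [qbar, AffineAveraging.contourSum, Pi.smul_apply, smul_eq_mul, ← Finset.mul_sum]
  ring

/-- [folklore] **`σ^{(m)}` IS ℝ-HOMOGENEOUS.** -/
theorem symNestGaugeAt_smul (ρ : Site d) (Lc : ℕ) (c : ℝ) : ∀ (m : ℕ) (A : Form1 d ℝ),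
    symNestGaugeAt ρ Lc m (c • A) = c • symNestGaugeAt ρ Lc m A
  | 0, A => by rw [symNestGaugeAt_zero_left, symNestGaugeAt_zero_left, smul_zero]
  | m + 1, A => by
      rw [symNestGaugeAt_succ, symNestGaugeAt_succ, qbar_smul, symNestGaugeAt_smul ρ Lc c m, symBmGaugeAt_smul, smul_add]
      rfl

/-- [folklore] **`Π^{(m)}_nest` IS ℝ-HOMOGENEOUS** — with its additivity (`symAxProjNestAt_add`) this is the Form-level content of asym1's units letter `hPu`
(a leg-type-constant rescaling of the field commutes with the dressing). -/
theorem symAxProjNestAt_smul (ρ : Site d) (Lc m : ℕ) (c : ℝ) (A : Form1 d ℝ) :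
    symAxProjNestAt ρ Lc m (c • A) = c • symAxProjNestAt ρ Lc m A := by
  rw [symAxProjNestAt, symAxProjNestAt, symNestGaugeAt_smul, smul_sub]
  congr 1
  funext κ x
  simp only [grad, Pi.smul_apply, smul_eq_mul, mul_sub]

/-- [folklore] `σ^{(m)}` is additive (from `symNestGaugeAt_sub`). -/
theorem symNestGaugeAt_add (ρ : Site d) (Lc m : ℕ) (A B : Form1 d ℝ) :
    symNestGaugeAt ρ Lc m (A + B) = symNestGaugeAt ρ Lc m A + symNestGaugeAt ρ Lc m B := by
  have h := symNestGaugeAt_sub ρ Lc m (A + B) B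
  rw [add_sub_cancel_right] at h
  rw [← sub_eq_iff_eq_add.mp h.symm]

/-- [folklore] `Π^{(m)}_nest` is additive. -/
theorem symAxProjNestAt_add (ρ : Site d) (Lc m : ℕ) (A B : Form1 d ℝ) :
    symAxProjNestAt ρ Lc m (A + B) = symAxProjNestAt ρ Lc m A + symAxProjNestAt ρ Lc m B := by
  have h := symAxProjNestAt_sub ρ Lc m (A + B) B
  rw [add_sub_cancel_right] at h
  rw [← sub_eq_iff_eq_add.mp h.symm]

/-! ## §2 Sup-bounds: every reading is a finite sum of `±A`-letters -/

/-- [folklore] The rooted comb integral of a sup-bounded field (in-block root; generic dimension): `|treeGaugeAt (toSite r) A N x| ≤ d·N·M` — at most `d·N` letters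
(an2's `axial_length_le_of_root`), each `±A κ z` (`mem_axial`). -/
theorem abs_treeGaugeAt_le_of_sup' {N : ℕ} (hN : 1 ≤ N) {r : Fin d → ℕ} (hr : r ∈ box d N) {A : Form1 d ℝ} {M : ℝ} (hM : 0 ≤ M)
    (hA : ∀ κ z, |A κ z| ≤ M) (x : Site d) : |treeGaugeAt (toSite r) A N x| ≤ (d : ℝ) * N * M := by
  unfold treeGaugeAt
  have h1 : ∀ a ∈ axial A ((N : ℤ) • blk N x + toSite r) x, |a| ≤ M := by
    intro a ha
    obtain ⟨κ, z', e | e⟩ := mem_axial ha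
    · rw [e]; exact hA κ z'
    · rw [e, abs_neg]; exact hA κ z'
  have h3 : ((axial A ((N : ℤ) • blk N x + toSite r) x).length : ℝ) ≤ (d : ℝ) * N := by
    exact_mod_cast axial_length_le_of_root hN hr A x
  exact (abs_list_sum_le h1).trans (mul_le_mul_of_nonneg_right h3 hM)

/-- [folklore] The SYMMETRISED tree integral of a sup-bounded field: `|symTreeGaugeAt (toSite r) A N x| ≤ d!·(d·N·M)` (sum over the `d!` axis orders of the comb
case in permuted coordinates). -/
theorem abs_symTreeGaugeAt_le_of_sup {N : ℕ} (hN : 1 ≤ N) {r : Fin d → ℕ} (hr : r ∈ box d N) {A : Form1 d ℝ} {M : ℝ} (hM : 0 ≤ M)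
    (hA : ∀ κ z, |A κ z| ≤ M) (x : Site d) : |symTreeGaugeAt (toSite r) A N x| ≤ (d ! : ℝ) * ((d : ℝ) * N * M) := by
  rw [symTreeGaugeAt_eq_sum]
  refine (Finset.abs_sum_le_sum_abs _ _).trans ?_
  have hσ : ∀ σ : Equiv.Perm (Fin d), |treeGaugeAt ((psite σ).symm (toSite r)) (P1 σ A) N ((psite σ).symm x)| ≤ (d : ℝ) * N * M := by
    intro σ
    have hrσ : (psite σ).symm r ∈ box d N := by rw [psite_symm_apply_eq]; exact psite_mem_box σ⁻¹ hr
    have e : (psite σ).symm (toSite r) = toSite ((psite σ).symm r) := rfl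
    rw [e]
    exact abs_treeGaugeAt_le_of_sup' hN hrσ hM (fun κ z => by rw [P1_apply]; exact hA _ _) _
  refine (Finset.sum_le_sum fun σ _ => hσ σ).trans ?_
  rw [Finset.sum_const, Finset.card_univ, card_perm_fin, nsmul_eq_mul]

/-- [folklore] … hence `|symGaugeAt (toSite r) A N x| ≤ d·N·M`. -/
theorem abs_symGaugeAt_le_of_sup {N : ℕ} (hN : 1 ≤ N) {r : Fin d → ℕ} (hr : r ∈ box d N) {A : Form1 d ℝ} {M : ℝ} (hM : 0 ≤ M)
    (hA : ∀ κ z, |A κ z| ≤ M) (x : Site d) : |symGaugeAt (toSite r) A N x| ≤ (d : ℝ) * N * M := by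
  have hfac : (0 : ℝ) < d ! := by exact_mod_cast Nat.factorial_pos d
  show |(d ! : ℝ)⁻¹ * symTreeGaugeAt (toSite r) A N x| ≤ _
  rw [abs_mul, abs_inv, abs_of_pos hfac]
  have h := abs_symTreeGaugeAt_le_of_sup hN hr hM hA x
  calc (d ! : ℝ)⁻¹ * |symTreeGaugeAt (toSite r) A N x| ≤ (d ! : ℝ)⁻¹ * ((d ! : ℝ) * ((d : ℝ) * N * M)) :=
        mul_le_mul_of_nonneg_left h (inv_nonneg.mpr hfac.le)
    _ = (d : ℝ) * N * M := by rw [← mul_assoc, inv_mul_cancel₀ hfac.ne', one_mul]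

/-- [folklore] A block mean of a sup-bounded function is sup-bounded by the same constant (`N ≥ 1`; generic dimension). -/
theorem abs_blockMeanAt_le_of_sup' {N : ℕ} (hN : 1 ≤ N) {g : Form0 d ℝ} {M : ℝ} (hg : ∀ w, |g w| ≤ M) (x : Site d) :
    |blockMeanAt N g x| ≤ M := by
  have hcard : (box d N).card = N ^ d := by
    simp only [AffineAveraging.box, Fintype.card_piFinset, Finset.card_range, Finset.prod_const, Finset.card_univ, Fintype.card_fin]
  have hNd : (0 : ℝ) < (N : ℝ) ^ d := pow_pos (by exact_mod_cast hN) _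
  show |(∑ b ∈ box d N, g ((N : ℤ) • blk N x + toSite b)) / ((N : ℝ) ^ d)| ≤ M
  rw [abs_div, abs_of_pos hNd, div_le_iff₀ hNd]
  refine (Finset.abs_sum_le_sum_abs _ _).trans ?_
  refine (Finset.sum_le_sum fun b _ => hg _).trans ?_
  rw [Finset.sum_const, hcard, nsmul_eq_mul]
  push_cast
  rw [mul_comm]

/-- [folklore] **`|σ₁ A x| ≤ 2·(d·N·M)`** for a sup-bounded field (in-block root). -/
theorem abs_symBmGaugeAt_le_of_sup {N : ℕ} (hN : 1 ≤ N) {r : Fin d → ℕ} (hr : r ∈ box d N) {A : Form1 d ℝ} {M : ℝ} (hM : 0 ≤ M)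
    (hA : ∀ κ z, |A κ z| ≤ M) (x : Site d) : |symBmGaugeAt (toSite r) A N x| ≤ 2 * ((d : ℝ) * N * M) := by
  show |symGaugeAt (toSite r) A N x - blockMeanAt N (symGaugeAt (toSite r) A N) x| ≤ _
  have h1 := abs_symGaugeAt_le_of_sup hN hr hM hA x
  have h2 := abs_blockMeanAt_le_of_sup' hN (fun w => abs_symGaugeAt_le_of_sup hN hr hM hA w) x
  calc _ ≤ |symGaugeAt (toSite r) A N x| + |blockMeanAt N (symGaugeAt (toSite r) A N) x| := abs_sub _ _
    _ ≤ _ := by linarith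

/-- [folklore] The straight block-contour sum of a sup-bounded field: `|contourSum L A κ y| ≤ L^d·(L·M)`. -/
theorem abs_contourSum_le_of_sup' (L : ℕ) {A : Form1 d ℝ} {M : ℝ} (hA : ∀ κ z, |A κ z| ≤ M) (κ : Fin d) (y : Site d) :
    |contourSum L A κ y| ≤ ((L : ℝ) ^ d) * ((L : ℝ) * M) := by
  have hcard : (box d L).card = L ^ d := by
    simp only [AffineAveraging.box, Fintype.card_piFinset, Finset.card_range, Finset.prod_const, Finset.card_univ, Fintype.card_fin]
  simp only [AffineAveraging.contourSum]
  refine (Finset.abs_sum_le_sum_abs _ _).trans ?_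
  refine (Finset.sum_le_sum fun b _ => (Finset.abs_sum_le_sum_abs _ _).trans (Finset.sum_le_sum fun s _ => hA κ _)).trans ?_
  simp only [Finset.sum_const, Finset.card_range, hcard, nsmul_eq_mul]
  push_cast
  exact le_rfl

/-- [folklore] **`|𝒬̄_L A| ≤ L·M`** for a sup-bounded field (`L ≥ 1`). -/
theorem abs_qbar_le_of_sup {L : ℕ} (hL : 1 ≤ L) {A : Form1 d ℝ} {M : ℝ} (hA : ∀ κ z, |A κ z| ≤ M) (κ : Fin d) (y : Site d) :
    |qbar L A κ y| ≤ (L : ℝ) * M := by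
  have hLd : (0 : ℝ) < (L : ℝ) ^ d := pow_pos (by exact_mod_cast hL) _
  show |(((L : ℝ) ^ d))⁻¹ * contourSum L A κ y| ≤ _
  rw [abs_mul, abs_inv, abs_of_pos hLd]
  calc ((L : ℝ) ^ d)⁻¹ * |contourSum L A κ y| ≤ ((L : ℝ) ^ d)⁻¹ * (((L : ℝ) ^ d) * ((L : ℝ) * M)) :=
        mul_le_mul_of_nonneg_left (abs_contourSum_le_of_sup' L hA κ y) (inv_nonneg.mpr hLd.le)
    _ = (L : ℝ) * M := by rw [← mul_assoc, inv_mul_cancel₀ hLd.ne', one_mul]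

/-- [folklore] **`|𝒬̄_L^k A| ≤ L^k·M`** (`L ≥ 1`). -/
theorem abs_qbar_iterate_le_of_sup {L : ℕ} (hL : 1 ≤ L) : ∀ (k : ℕ) {A : Form1 d ℝ} {M : ℝ}, (∀ κ z, |A κ z| ≤ M) →
    ∀ κ y, |(qbar L)^[k] A κ y| ≤ (L : ℝ) ^ k * M
  | 0, A, M, hA, κ, y => by simpa using hA κ y
  | k + 1, A, M, hA, κ, y => by
      rw [Function.iterate_succ_apply, pow_succ, mul_assoc]
      exact abs_qbar_iterate_le_of_sup hL k (fun κ' z => abs_qbar_le_of_sup hL hA κ' z) κ y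

/-- [folklore] **THE NESTED FUNCTIONAL OF A SUP-BOUNDED FIELD**: `|σ^{(m)} A x| ≤ 2·d·(m·Lc^m)·M` (in-block root `r ∈ box d Lc`, `Lc ≥ 1`; `m` levels, the
level-`k` summand `≤ 2·d·Lc·(Lc^k·M) ≤ 2·d·Lc^m·M`). Uniform in the root and in any background index; the constant per `m` is free (asym1 (b)). -/
theorem abs_symNestGaugeAt_le_of_sup {Lc : ℕ} (hLc : 1 ≤ Lc) {r : Fin d → ℕ} (hr : r ∈ box d Lc) {A : Form1 d ℝ} {M : ℝ} (hM : 0 ≤ M)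
    (hA : ∀ κ z, |A κ z| ≤ M) (m : ℕ) (x : Site d) :
    |symNestGaugeAt (toSite r) Lc m A x| ≤ 2 * (d : ℝ) * ((m : ℝ) * (Lc : ℝ) ^ m) * M := by
  rw [symNestGaugeAt_eq_sum]
  refine (Finset.abs_sum_le_sum_abs _ _).trans ?_
  have hL1 : (1 : ℝ) ≤ Lc := by exact_mod_cast hLc
  have hk : ∀ k ∈ Finset.range m,
      |symBmGaugeAt (toSite r) ((qbar Lc)^[k] A) Lc (blk (Lc ^ k) x)| ≤ 2 * (d : ℝ) * (Lc : ℝ) ^ m * M := by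
    intro k hk
    have hkm : k + 1 ≤ m := Finset.mem_range.mp hk
    have h := abs_symBmGaugeAt_le_of_sup hLc hr (M := (Lc : ℝ) ^ k * M) (by positivity)
      (fun κ z => abs_qbar_iterate_le_of_sup hLc k hA κ z) (blk (Lc ^ k) x)
    have hpow : (Lc : ℝ) * (Lc : ℝ) ^ k ≤ (Lc : ℝ) ^ m := by
      rw [← pow_succ']; exact pow_le_pow_right₀ hL1 hkm
    have hd : (0 : ℝ) ≤ d := Nat.cast_nonneg d
    calc _ ≤ 2 * ((d : ℝ) * Lc * ((Lc : ℝ) ^ k * M)) := h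
      _ = 2 * (d : ℝ) * ((Lc : ℝ) * (Lc : ℝ) ^ k) * M := by ring
      _ ≤ 2 * (d : ℝ) * (Lc : ℝ) ^ m * M := by gcongr
  refine (Finset.sum_le_sum hk).trans ?_
  rw [Finset.sum_const, Finset.card_range, nsmul_eq_mul]
  ring_nf
  exact le_rfl

/-- [folklore] **THE NESTED PROJECTOR OF A SUP-BOUNDED FIELD**: `|(Π^{(m)}_nest A)_κ(x)| ≤ (1 + 4·d·(m·Lc^m))·M` — asym1's operator-bound letter `hΠbd` in sup form
(the `ℓ¹→ℓ¹` form follows with FILE 2's window); constant per `m`, uniform in root and background. -/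
theorem abs_symAxProjNestAt_le_of_sup {Lc : ℕ} (hLc : 1 ≤ Lc) {r : Fin d → ℕ} (hr : r ∈ box d Lc) {A : Form1 d ℝ} {M : ℝ} (hM : 0 ≤ M)
    (hA : ∀ κ z, |A κ z| ≤ M) (m : ℕ) (κ : Fin d) (x : Site d) :
    |symAxProjNestAt (toSite r) Lc m A κ x| ≤ (1 + 4 * (d : ℝ) * ((m : ℝ) * (Lc : ℝ) ^ m)) * M := by
  show |A κ x - (symNestGaugeAt (toSite r) Lc m A (x + unitVec κ) - symNestGaugeAt (toSite r) Lc m A x)| ≤ _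
  have h0 := hA κ x
  have h1 := abs_symNestGaugeAt_le_of_sup hLc hr hM hA m (x + unitVec κ)
  have h2 := abs_symNestGaugeAt_le_of_sup hLc hr hM hA m x
  calc _ ≤ |A κ x| + |symNestGaugeAt (toSite r) Lc m A (x + unitVec κ) - symNestGaugeAt (toSite r) Lc m A x| := abs_sub _ _
    _ ≤ |A κ x| + (|symNestGaugeAt (toSite r) Lc m A (x + unitVec κ)| + |symNestGaugeAt (toSite r) Lc m A x|) := by
        gcongr; exact abs_sub _ _
    _ ≤ M + (2 * (d : ℝ) * ((m : ℝ) * (Lc : ℝ) ^ m) * M + 2 * (d : ℝ) * ((m : ℝ) * (Lc : ℝ) ^ m) * M) := by linarith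
    _ = (1 + 4 * (d : ℝ) * ((m : ℝ) * (Lc : ℝ) ^ m)) * M := by ring

/-! ## §3 The matrix window: an entry vanishes unless the source bond is the target bond or lies in one of the two `Lc^m`-blocks met by it -/

/-- [folklore] `Π^{(m)}_nest 0 = 0`. -/
theorem symAxProjNestAt_map_zero (ρ : Site d) (Lc m : ℕ) : symAxProjNestAt ρ Lc m (0 : Form1 d ℝ) = 0 := by
  rw [symAxProjNestAt, symNestGaugeAt_map_zero, grad_zero, sub_zero]

/-- [folklore] **THE WINDOW**: if `A` vanishes on the bond `(κ, x)` and on every bond with both endpoints in the `Lc^m`-block of `x` or of `x + e_κ`, then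
`(Π^{(m)}_nest A)_κ(x) = 0` (FILE 2's read set against the zero field) — so the matrix entry `(Π^{(m)}_nest δ_{(α,q)})_κ(x)` vanishes unless `(α, q) = (κ, x)` or the
bond `(α, q)` lies inside one of the two `Lc^m`-blocks met by `(κ, x)`. -/
theorem symAxProjNestAt_apply_eq_zero_of_vanish {Lc : ℕ} (hLc : 1 ≤ Lc) {r : Fin d → ℕ} (hr : r ∈ box d Lc) (m : ℕ) (κ : Fin d) (x : Site d)
    {A : Form1 d ℝ} (h0 : A κ x = 0)
    (h1 : ∀ κ' y, blk (Lc ^ m) y = blk (Lc ^ m) x → blk (Lc ^ m) (y + unitVec κ') = blk (Lc ^ m) x → A κ' y = 0)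
    (h2 : ∀ κ' y, blk (Lc ^ m) y = blk (Lc ^ m) (x + unitVec κ) → blk (Lc ^ m) (y + unitVec κ') = blk (Lc ^ m) (x + unitVec κ) → A κ' y = 0) :
    symAxProjNestAt (toSite r) Lc m A κ x = 0 := by
  have h := symAxProjNestAt_apply_eq_of_forall hLc hr m κ x (A := A) (B := 0) (by rw [h0]; rfl)
    (fun κ' y hy hy' => by rw [h1 κ' y hy hy']; rfl) (fun κ' y hy hy' => by rw [h2 κ' y hy hy']; rfl)
  rw [h, symAxProjNestAt_map_zero]
  rfl


/-! ## §4 The tower: the nesting is associative, and the nested ranges decrease with the depth -/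

/-- [folklore] Lifts compose: `liftBlk L (liftBlk M ψ) = liftBlk (L·M) ψ` (`blk_blk'`). -/
theorem liftBlk_liftBlk (L M : ℕ) (ψ : Form0 d ℝ) : liftBlk L (liftBlk M ψ) = liftBlk (L * M) ψ := by
  funext x
  simp only [liftBlk, blk_blk']

/-- [folklore] `liftBlk 1 = id`. -/
theorem liftBlk_one (ψ : Form0 d ℝ) : liftBlk 1 ψ = ψ := by
  funext x
  simp only [liftBlk, blk_one]

/-- [folklore] **THE NESTING IS ASSOCIATIVE**: `σ^{(m+k)} A = σ^{(m)} A + (σ^{(k)} (𝒬̄^m A)) ∘ blk (Lc^m)` — the `(m+k)`-fold nested gauge is the `m`-fold one plus the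
`k`-fold one of the `m`-fold averaged field, read through the `Lc^m`-block label. -/
theorem symNestGaugeAt_add_levels (ρ : Site d) (Lc : ℕ) : ∀ (m k : ℕ) (A : Form1 d ℝ),
    symNestGaugeAt ρ Lc (m + k) A = symNestGaugeAt ρ Lc m A + liftBlk (Lc ^ m) (symNestGaugeAt ρ Lc k ((qbar Lc)^[m] A))
  | 0, k, A => by
      rw [Nat.zero_add, symNestGaugeAt_zero_left, zero_add, pow_zero, liftBlk_one]
      rfl
  | m + 1, k, A => by
      rw [Nat.succ_add, symNestGaugeAt_succ, symNestGaugeAt_succ, symNestGaugeAt_add_levels ρ Lc m k (qbar Lc A), add_assoc]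
      congr 1
      show liftBlk Lc (symNestGaugeAt ρ Lc m (qbar Lc A) + liftBlk (Lc ^ m) (symNestGaugeAt ρ Lc k ((qbar Lc)^[m] (qbar Lc A)))) = _
      rw [show (qbar Lc)^[m] (qbar Lc A) = (qbar Lc)^[m + 1] A from (Function.iterate_succ_apply (qbar Lc) m A).symm, pow_succ',
        ← liftBlk_liftBlk]
      rfl

/-- [folklore] **A DEEPER NESTED PROJECTION IS IN EVERY SHALLOWER NESTED SLICE**: `σ^{(m)} (Π^{(m+k)}_nest A) = 0` (`Lc ≥ 1`). -/
theorem symNestGaugeAt_symAxProjNestAt_add {Lc : ℕ} (hLc : 1 ≤ Lc) (ρ : Site d) (m k : ℕ) (A : Form1 d ℝ) :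
    symNestGaugeAt ρ Lc m (symAxProjNestAt ρ Lc (m + k) A) = 0 := by
  rw [symAxProjNestAt, symNestGaugeAt_sub, symNestGaugeAt_grad hLc]
  have hsplit := symNestGaugeAt_add_levels ρ Lc m k A
  have hbm : blockMeanAt (Lc ^ m) (symNestGaugeAt ρ Lc (m + k) A) = liftBlk (Lc ^ m) (symNestGaugeAt ρ Lc k ((qbar Lc)^[m] A)) := by
    have h := blockMeanAt_sub (Lc ^ m) (symNestGaugeAt ρ Lc (m + k) A) (symNestGaugeAt ρ Lc m A)
    rw [blockMeanAt_symNestGaugeAt hLc, sub_zero] at h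
    rw [← h, hsplit, add_sub_cancel_left, blockMeanAt_liftBlk (Nat.one_le_pow _ _ hLc)]
  rw [hbm, hsplit]
  abel

/-- [folklore] **THE TOWER**: `Π^{(m)}_nest (Π^{(m+k)}_nest A) = Π^{(m+k)}_nest A` — the nested ranges DECREASE with the depth (`k = 0`: idempotence; `m = 1`: `Π̂₁ ∘ Π^{(1+k)} =
Π^{(1+k)}`, the Form-level twin of the owner's matrix factorisation `Π_nest = Π₁·G` read as `Π₁Π_nest = Π_nest`; leaf-02 g14's (E2)/(E3) of C-d1leaf02g14-3). -/
theorem symAxProjNestAt_symAxProjNestAt_add {Lc : ℕ} (hLc : 1 ≤ Lc) (ρ : Site d) (m k : ℕ) (A : Form1 d ℝ) :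
    symAxProjNestAt ρ Lc m (symAxProjNestAt ρ Lc (m + k) A) = symAxProjNestAt ρ Lc (m + k) A := by
  show symAxProjNestAt ρ Lc (m + k) A - grad (symNestGaugeAt ρ Lc m (symAxProjNestAt ρ Lc (m + k) A)) = _
  rw [symNestGaugeAt_symAxProjNestAt_add hLc, grad_zero, sub_zero]

/-- [folklore] In particular the literal's one-step projector fixes every nested projection: `Π̂₁ (Π^{(k+1)}_nest A) = Π^{(k+1)}_nest A`. -/
theorem symAxProjBmAt_symAxProjNestAt_succ {Lc : ℕ} (hLc : 1 ≤ Lc) (ρ : Site d) (k : ℕ) (A : Form1 d ℝ) :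
    symAxProjBmAt ρ Lc (symAxProjNestAt ρ Lc (k + 1) A) = symAxProjNestAt ρ Lc (k + 1) A := by
  have h := symAxProjNestAt_symAxProjNestAt_add hLc ρ 1 k A
  rw [Nat.add_comm 1 k] at h
  rw [← Summit.QuantumFields.BalabanUV.Beta.FP.NestedDressingProjector.symAxProjNestAt_one]
  exact h

end

end Summit.QuantumFields.BalabanUV.Beta.FP.NestedDressingProjectorBounds
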